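import Summits.CriticalPhenomena.PercolationContinuityZ3.Theorems.PercNearOneGluingNoHeavyLowerTailKnQuestion8CoefficientwiseGluing
import HarnessLib

/-!
# Doubling an edge: `T'(H + e') = T'(H) + 2·T'(H/e)` — the multigraph first rung reduces to simple graphs

Support file (`--supports stmt-CriticalPhenomena-4575`, closed), prover `prim-lf-2` (gen 26).  No definitions, no named facts, no sorries; standard axioms.
Memo `prim-lf-2/CW-REDUCTION-gen26.md` §1 (DOUBLING LEMMA); companions `…CoefficientwiseSeries/Decoration/ParallelClosure.lean` (THEOREM SP).

The class `𝒞`: `(E; x, z) ∈ 𝒞` (for the end-point map `ends`) iff for all monotone `f, g : Set V → ℝ`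
  `0 ≤ Σ_{s ⊆ E : z ∉ C_x(s), z ∉ C_x(E∖s)} (f(C_x s) − f(C_x(E∖s)))·(g(C_x s) − g(C_x(E∖s)))`,  `C_x(s) = openCluster (ends '' s) x`.

* `Coefficientwise.mem_openCluster_insert_contract` — contracting an edge `e = {u,v}`: with the relabelling `r = (v ↦ u)`, for every colouring `t`,
  `y ∈ C_x(t ∪ {e})` iff `r y ∈ C_x^{r∘ends}(t)` (the red cluster with `e` red is the pull-back of the cluster in the contracted multigraph `H/e`, whose
  end-point map is `Sym2.map r ∘ ends`; edges parallel to `e` become loops, which `SimpleGraph.fromEdgeSet` ignores).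
* `Coefficientwise.cwpa_double` — **DOUBLING LEMMA**: if `e ∈ E`, `e' ∉ E` has the same ends `{u,v}` (`u ≠ v`, `v ∉ {x,z}`), and both `(E; x,z)` (for `ends`)
  and the contraction `(E ∖ {e}; x, z)` (for `Sym2.map r ∘ ends`) are in `𝒞`, then `(E ∪ {e'}; x, z) ∈ 𝒞`.  Indeed
  `T'(E ∪ {e'})[f,g] = T'(E)[f,g] + 2·T'(E∖{e}, contracted)[f ∘ r⁻¹, g ∘ r⁻¹]`: the colourings with `e, e'` of equal colour are the colourings of `E`, those with
  different colours see `u, v` joined in both colours, i.e. the contracted graph.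
Consequence (memo §1): the first rung for all finite multigraphs follows from the first rung for all finite simple graphs.
[cite: KozmaNitzan2024, Questions 8–9 (§5.5 p. 36) (context: first rung of the coefficientwise programme for Question 8)]
-/

namespace Summit.CriticalPhenomena.PercolationContinuityZ3.Theorems

open Finset Literature.Probability.Percolation

namespace Coefficientwise

variable {ι V : Type*} [DecidableEq ι] [DecidableEq V]

/-- **Contraction of an edge.**  Let `e` have ends `{u, v}` with `u ≠ v`, let `r` send `v` to `u` and fix every other vertex, and let `x ≠ v`.  For every set
`t` of red edges, `y` lies in the red cluster of `x` for `t ∪ {e}` iff `r y` lies in the red cluster of `x` in the contracted multigraph (end-point map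
`Sym2.map r ∘ ends`, red edges `t`).  [cite: KozmaNitzan2024, §5.5 (context only; folklore)] -/
theorem mem_openCluster_insert_contract (ends : ι → Sym2 V) {t : Finset ι} {e : ι} {u v x : V}
    (he : ends e = s(u, v)) (huv : u ≠ v) (hxv : x ≠ v) (y : V) :
    y ∈ openCluster (ends '' (↑(insert e t) : Set ι)) x ↔
      (if y = v then u else y) ∈
        openCluster ((fun i => Sym2.map (fun w => if w = v then u else w) (ends i)) '' (↑t : Set ι)) x := by
  set r : V → V := fun w => if w = v then u else w with hr
  set ends' : ι → Sym2 V := fun i => Sym2.map r (ends i) with hends'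
  have hrx : r x = x := by simp [hr, hxv]
  have hrv : r v = u := by simp [hr]
  have hru : r u = u := by simp [hr]
  -- two vertices with the same image are equal or form the pair `{u, v}`, hence are joined by `e`
  have r_fibre : ∀ a b : V, r a = r b → a = b ∨ (a = u ∧ b = v) ∨ (a = v ∧ b = u) := by
    intro a b hab
    simp only [hr] at hab
    by_cases ha : a = v <;> by_cases hb : b = v
    · exact Or.inl (ha.trans hb.symm)
    · rw [if_pos ha, if_neg hb] at hab; exact Or.inr (Or.inr ⟨ha, hab.symm⟩)
    · rw [if_neg ha, if_pos hb] at hab; exact Or.inr (Or.inl ⟨hab, hb⟩)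
    · rw [if_neg ha, if_neg hb] at hab; exact Or.inl hab
  have reach_of_r_eq : ∀ a b : V, r a = r b → (openGraph (ends '' (↑(insert e t) : Set ι))).Reachable a b := by
    intro a b hab
    have hadj_uv : (openGraph (ends '' (↑(insert e t) : Set ι))).Adj u v := by
      rw [openGraph_image_adj]; exact ⟨⟨e, Finset.mem_insert_self e t, he⟩, huv⟩
    rcases r_fibre a b hab with h | ⟨rfl, rfl⟩ | ⟨rfl, rfl⟩
    · rw [h]
    · exact hadj_uv.reachable
    · exact hadj_uv.symm.reachable
  constructor
  · -- push a walk of `t ∪ {e}` down to the contraction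
    intro hy
    change (openGraph (ends '' (↑(insert e t) : Set ι))).Reachable x y at hy
    rw [SimpleGraph.reachable_iff_reflTransGen] at hy
    change (openGraph (ends' '' (↑t : Set ι))).Reachable x (r y)
    induction hy with
    | refl => rw [hrx]
    | @tail b c _ hbc ih =>
      rw [openGraph_image_adj] at hbc
      obtain ⟨⟨i, hi, hiends⟩, hne⟩ := hbc
      rcases Finset.mem_insert.mp hi with rfl | hit
      · -- the step uses `e` itself: `{b, c} = {u, v}`, same image
        have hbc' : s(b, c) = s(u, v) := hiends.symm.trans he
        have : r b = r c := by
          rcases Sym2.eq_iff.mp hbc' with ⟨rfl, rfl⟩ | ⟨rfl, rfl⟩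
          · rw [hru, hrv]
          · rw [hrv, hru]
        rw [← this]; exact ih
      · by_cases hrbc : r b = r c
        · rw [← hrbc]; exact ih
        · have hadj : (openGraph (ends' '' (↑t : Set ι))).Adj (r b) (r c) := by
            rw [openGraph_image_adj]
            refine ⟨⟨i, hit, ?_⟩, hrbc⟩
            simp only [hends', hiends, Sym2.map_mk]
          exact SimpleGraph.Reachable.trans ih hadj.reachable
  · -- lift a walk of the contraction
    intro hy
    change (openGraph (ends' '' (↑t : Set ι))).Reachable x (r y) at hy
    rw [SimpleGraph.reachable_iff_reflTransGen] at hy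
    change (openGraph (ends '' (↑(insert e t) : Set ι))).Reachable x y
    -- generalise over the end vertex: every `y'` with `r y' =` the current vertex is reachable
    suffices H : ∀ a : V, Relation.ReflTransGen (openGraph (ends' '' (↑t : Set ι))).Adj x a →
        ∀ y' : V, r y' = a → (openGraph (ends '' (↑(insert e t) : Set ι))).Reachable x y' from H (r y) hy y rfl
    intro a ha
    induction ha with
    | refl =>
      intro y' hy'
      exact reach_of_r_eq x y' (hrx.trans hy'.symm)
    | @tail b c _ hbc ih =>
      intro y' hy'
      rw [openGraph_image_adj] at hbc
      obtain ⟨⟨i, hit, hiends⟩, hne⟩ := hbc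
      -- `ends i = s(p, q)` with `{r p, r q} = {b, c}`
      obtain ⟨⟨p, q⟩, hpq0⟩ := Quot.exists_rep (ends i)
      have hpq : ends i = s(p, q) := hpq0.symm
      have himg : s(r p, r q) = s(b, c) := by
        have := hiends
        simp only [hends', hpq, Sym2.map_mk] at this
        exact this
      have hadj_pq : (openGraph (ends '' (↑(insert e t) : Set ι))).Adj p q := by
        rw [openGraph_image_adj]
        refine ⟨⟨i, Finset.mem_insert_of_mem hit, hpq⟩, ?_⟩
        intro hpq'
        rw [hpq'] at himg
        exact hne (Sym2.eq_iff.mp himg |>.elim (fun h => h.1.symm.trans h.2) (fun h => h.2.symm.trans h.1))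
      rcases Sym2.eq_iff.mp himg with ⟨hpb, hqc⟩ | ⟨hpc, hqb⟩
      · -- `r p = b`, `r q = c`
        have h1 := ih p hpb
        have h2 : (openGraph (ends '' (↑(insert e t) : Set ι))).Reachable q y' := reach_of_r_eq q y' (hqc.trans hy'.symm)
        exact (h1.trans hadj_pq.reachable).trans h2
      · -- `r q = b`, `r p = c`
        have h1 := ih q hqb
        have h2 : (openGraph (ends '' (↑(insert e t) : Set ι))).Reachable p y' := reach_of_r_eq p y' (hpc.trans hy'.symm)
        exact (h1.trans hadj_pq.symm.reachable).trans h2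

open Classical in
/-- **DOUBLING LEMMA** (memo `prim-lf-2/CW-REDUCTION-gen26.md` §1).  Let `e ∈ E` have ends `{u,v}` (`u ≠ v`, `v ≠ x`, `v ≠ z`) and let `e' ∉ E` be a new edge
with the same ends.  If `(E; x, z)` satisfies the coefficientwise first rung for `ends`, and the contraction `(E ∖ {e}; x, z)` satisfies it for the contracted
end-point map `Sym2.map (v ↦ u) ∘ ends`, then `(E ∪ {e'}; x, z)` satisfies it for `ends`: the colourings of `E ∪ {e'}` in which `e, e'` have the same colour
contribute `T'(E)`, those with different colours contribute `2·T'(E∖{e}, contracted)` evaluated at the monotone pull-backs `W ↦ f {y | r y ∈ W}`.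
[cite: KozmaNitzan2024, Questions 8–9 (§5.5 p. 36) (context)] -/
theorem cwpa_double (ends : ι → Sym2 V) {E : Finset ι} {e e' : ι} {u v x z : V}
    (he : ends e = s(u, v)) (he' : ends e' = s(u, v)) (huv : u ≠ v) (hxv : x ≠ v) (hzv : z ≠ v)
    (heE : e ∈ E) (he'E : e' ∉ E)
    (h₁ : ∀ φ ψ : Set V → ℝ, Monotone φ → Monotone ψ →
      0 ≤ ∑ s ∈ E.powerset.filter (fun s : Finset ι => z ∉ openCluster (ends '' (↑s : Set ι)) x ∧
            z ∉ openCluster (ends '' (↑(E \ s) : Set ι)) x),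
        (φ (openCluster (ends '' (↑s : Set ι)) x) - φ (openCluster (ends '' (↑(E \ s) : Set ι)) x)) *
          (ψ (openCluster (ends '' (↑s : Set ι)) x) - ψ (openCluster (ends '' (↑(E \ s) : Set ι)) x)))
    (h₂ : ∀ φ ψ : Set V → ℝ, Monotone φ → Monotone ψ →
      0 ≤ ∑ s ∈ (E.erase e).powerset.filter (fun s : Finset ι =>
            z ∉ openCluster ((fun i => Sym2.map (fun w => if w = v then u else w) (ends i)) '' (↑s : Set ι)) x ∧
            z ∉ openCluster ((fun i => Sym2.map (fun w => if w = v then u else w) (ends i)) '' (↑((E.erase e) \ s) : Set ι)) x),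
        (φ (openCluster ((fun i => Sym2.map (fun w => if w = v then u else w) (ends i)) '' (↑s : Set ι)) x) -
            φ (openCluster ((fun i => Sym2.map (fun w => if w = v then u else w) (ends i)) '' (↑((E.erase e) \ s) : Set ι)) x)) *
          (ψ (openCluster ((fun i => Sym2.map (fun w => if w = v then u else w) (ends i)) '' (↑s : Set ι)) x) -
            ψ (openCluster ((fun i => Sym2.map (fun w => if w = v then u else w) (ends i)) '' (↑((E.erase e) \ s) : Set ι)) x)))
    (f g : Set V → ℝ) (hf : Monotone f) (hg : Monotone g) :
    0 ≤ ∑ s ∈ (insert e' E).powerset.filter (fun s : Finset ι => z ∉ openCluster (ends '' (↑s : Set ι)) x ∧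
          z ∉ openCluster (ends '' (↑((insert e' E) \ s) : Set ι)) x),
      (f (openCluster (ends '' (↑s : Set ι)) x) - f (openCluster (ends '' (↑((insert e' E) \ s) : Set ι)) x)) *
        (g (openCluster (ends '' (↑s : Set ι)) x) - g (openCluster (ends '' (↑((insert e' E) \ s) : Set ι)) x)) := by
  -- notation
  set r : V → V := fun w => if w = v then u else w with hr
  set ends' : ι → Sym2 V := fun i => Sym2.map r (ends i) with hends'
  set K : Finset ι → Set V := fun s => openCluster (ends '' (↑s : Set ι)) x with hK
  set Kc : Finset ι → Set V := fun s => openCluster (ends' '' (↑s : Set ι)) x with hKc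
  set E₀ : Finset ι := E.erase e with hE₀
  change 0 ≤ ∑ s ∈ (insert e' E).powerset.filter (fun s => z ∉ K s ∧ z ∉ K ((insert e' E) \ s)),
      (f (K s) - f (K ((insert e' E) \ s))) * (g (K s) - g (K ((insert e' E) \ s)))
  have h₁' : 0 ≤ ∑ s ∈ E.powerset.filter (fun s => z ∉ K s ∧ z ∉ K (E \ s)),
      (f (K s) - f (K (E \ s))) * (g (K s) - g (K (E \ s))) := h₁ f g hf hg
  -- the pull-back of `f` along `r`
  set fr : Set V → ℝ := fun W => f {y | r y ∈ W} with hfr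
  set gr : Set V → ℝ := fun W => g {y | r y ∈ W} with hgr
  have hfr_mono : Monotone fr := fun W W' hWW' => hf (fun y (hy : r y ∈ W) => hWW' hy)
  have hgr_mono : Monotone gr := fun W W' hWW' => hg (fun y (hy : r y ∈ W) => hWW' hy)
  have h₂' : 0 ≤ ∑ s ∈ E₀.powerset.filter (fun s => z ∉ Kc s ∧ z ∉ Kc (E₀ \ s)),
      (fr (Kc s) - fr (Kc (E₀ \ s))) * (gr (Kc s) - gr (Kc (E₀ \ s))) := h₂ fr gr hfr_mono hgr_mono
  -- basic finset facts
  have heE₀ : e ∉ E₀ := Finset.notMem_erase e E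
  have hE : E = insert e E₀ := (Finset.insert_erase heE).symm
  have he'E₀ : e' ∉ E₀ := fun h => he'E (Finset.mem_of_mem_erase h)
  have hee' : e ≠ e' := fun h => he'E (h ▸ heE)
  have he'E1 : e' ∉ insert e E₀ := by rw [← hE]; exact he'E
  -- contraction: clusters with `e` (or `e'`) red are pull-backs of contracted clusters
  have contract_e : ∀ t : Finset ι, K (insert e t) = {y | r y ∈ Kc t} := by
    intro t; ext y
    exact mem_openCluster_insert_contract ends he huv hxv y
  have contract_e' : ∀ t : Finset ι, K (insert e' t) = {y | r y ∈ Kc t} := by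
    intro t; ext y
    exact mem_openCluster_insert_contract ends he' huv hxv y
  have hzr : ∀ W : Set V, (z ∈ {y | r y ∈ W}) ↔ z ∈ W := by
    intro W
    have : r z = z := by simp [hr, hzv]
    simp [this]
  -- a parallel red edge adds nothing: same image set
  have image_ee' : ∀ t : Finset ι, ends '' (↑(insert e' (insert e t)) : Set ι) = ends '' (↑(insert e t) : Set ι) := by
    intro t
    rw [Finset.coe_insert, Set.image_insert_eq, he', ← he]
    exact Set.insert_eq_of_mem (Set.mem_image_of_mem ends (by simp))
  have image_e'_e : ∀ t : Finset ι, ends '' (↑(insert e' t) : Set ι) = ends '' (↑(insert e t) : Set ι) := by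
    intro t
    rw [Finset.coe_insert, Finset.coe_insert, Set.image_insert_eq, Set.image_insert_eq, he', he]
  -- complements inside `insert e' E`, for `t ⊆ E₀`
  have compl_a : ∀ t, t ⊆ E₀ → (insert e' E) \ t = insert e' (insert e (E₀ \ t)) := by
    intro t ht; rw [hE]; ext i
    simp only [Finset.mem_sdiff, Finset.mem_insert]
    constructor
    · rintro ⟨h | h | h, hnt⟩
      · exact Or.inl h
      · exact Or.inr (Or.inl h)
      · exact Or.inr (Or.inr ⟨h, hnt⟩)
    · rintro (h | h | ⟨h, hnt⟩)
      · exact ⟨Or.inl h, fun hit => he'E₀ (h ▸ ht hit)⟩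
      · exact ⟨Or.inr (Or.inl h), fun hit => heE₀ (h ▸ ht hit)⟩
      · exact ⟨Or.inr (Or.inr h), hnt⟩
  have compl_b : ∀ t, t ⊆ E₀ → (insert e' E) \ (insert e t) = insert e' (E₀ \ t) := by
    intro t ht; rw [hE]; ext i
    simp only [Finset.mem_sdiff, Finset.mem_insert, not_or]
    constructor
    · rintro ⟨h | h | h, hne, hnt⟩
      · exact Or.inl h
      · exact absurd h hne
      · exact Or.inr ⟨h, hnt⟩
    · rintro (h | ⟨h, hnt⟩)
      · exact ⟨Or.inl h, fun h' => hee' (h'.symm.trans h), fun hit => he'E₀ (h ▸ ht hit)⟩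
      · exact ⟨Or.inr (Or.inr h), fun h' => heE₀ (h' ▸ h), hnt⟩
  have compl_c : ∀ t, t ⊆ E₀ → (insert e' E) \ (insert e' t) = insert e (E₀ \ t) := by
    intro t ht; rw [hE]; ext i
    simp only [Finset.mem_sdiff, Finset.mem_insert, not_or]
    constructor
    · rintro ⟨h | h | h, hne, hnt⟩
      · exact absurd h hne
      · exact Or.inl h
      · exact Or.inr ⟨h, hnt⟩
    · rintro (h | ⟨h, hnt⟩)
      · exact ⟨Or.inr (Or.inl h), fun h' => hee' (h.symm.trans h'), fun hit => heE₀ (h ▸ ht hit)⟩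
      · exact ⟨Or.inr (Or.inr h), fun h' => he'E₀ (h' ▸ h), hnt⟩
  have compl_d : ∀ t, t ⊆ E₀ → (insert e' E) \ (insert e' (insert e t)) = E₀ \ t := by
    intro t ht; rw [hE]; ext i
    simp only [Finset.mem_sdiff, Finset.mem_insert, not_or]
    constructor
    · rintro ⟨h | h | h, hne', hne, hnt⟩
      · exact absurd h hne'
      · exact absurd h hne
      · exact ⟨h, hnt⟩
    · rintro ⟨h, hnt⟩
      exact ⟨Or.inr (Or.inr h), fun h' => he'E₀ (h' ▸ h), fun h' => heE₀ (h' ▸ h), hnt⟩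
  have compl_H : ∀ t, t ⊆ E₀ → E \ t = insert e (E₀ \ t) := by
    intro t ht; rw [hE]; ext i
    simp only [Finset.mem_sdiff, Finset.mem_insert]
    constructor
    · rintro ⟨h | h, hnt⟩
      · exact Or.inl h
      · exact Or.inr ⟨h, hnt⟩
    · rintro (h | ⟨h, hnt⟩)
      · exact ⟨Or.inl h, fun hit => heE₀ (h ▸ ht hit)⟩
      · exact ⟨Or.inr h, hnt⟩
  have compl_H' : ∀ t, t ⊆ E₀ → E \ (insert e t) = E₀ \ t := by
    intro t ht; rw [hE]; ext i
    simp only [Finset.mem_sdiff, Finset.mem_insert, not_or]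
    constructor
    · rintro ⟨h | h, hne, hnt⟩
      · exact absurd h hne
      · exact ⟨h, hnt⟩
    · rintro ⟨h, hnt⟩
      exact ⟨Or.inr h, fun h' => heE₀ (h' ▸ h), hnt⟩
  -- the summands
  set T : Finset ι → ℝ := fun s => if z ∉ K s ∧ z ∉ K ((insert e' E) \ s)
      then (f (K s) - f (K ((insert e' E) \ s))) * (g (K s) - g (K ((insert e' E) \ s))) else 0 with hT
  set TH : Finset ι → ℝ := fun s => if z ∉ K s ∧ z ∉ K (E \ s)
      then (f (K s) - f (K (E \ s))) * (g (K s) - g (K (E \ s))) else 0 with hTH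
  set TC : Finset ι → ℝ := fun s => if z ∉ Kc s ∧ z ∉ Kc (E₀ \ s)
      then (fr (Kc s) - fr (Kc (E₀ \ s))) * (gr (Kc s) - gr (Kc (E₀ \ s))) else 0 with hTC
  rw [Finset.sum_filter]
  change 0 ≤ ∑ s ∈ (insert e' E).powerset, T s
  rw [hE, Finset.sum_powerset_insert he'E1, Finset.sum_powerset_insert heE₀,
    Finset.sum_congr rfl fun t _ => (rfl : T (insert e' t) = T (insert e' t)), Finset.sum_powerset_insert heE₀]
  -- identify the four families of summands
  have hA : ∀ t ∈ E₀.powerset, T t = TH t := by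
    intro t ht
    have ht' := Finset.mem_powerset.mp ht
    have hKc' : K ((insert e' E) \ t) = K (E \ t) := by
      rw [compl_a t ht', compl_H t ht']
      change openCluster (ends '' (↑(insert e' (insert e (E₀ \ t))) : Set ι)) x = openCluster (ends '' (↑(insert e (E₀ \ t)) : Set ι)) x
      rw [image_ee']
    simp only [hT, hTH, hKc']
  have hD : ∀ t ∈ E₀.powerset, T (insert e' (insert e t)) = TH (insert e t) := by
    intro t ht
    have ht' := Finset.mem_powerset.mp ht
    have hK1 : K (insert e' (insert e t)) = K (insert e t) := by
      change openCluster (ends '' (↑(insert e' (insert e t)) : Set ι)) x = openCluster (ends '' (↑(insert e t) : Set ι)) x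
      rw [image_ee']
    have hK2 : K ((insert e' E) \ (insert e' (insert e t))) = K (E \ (insert e t)) := by
      rw [compl_d t ht', compl_H' t ht']
    simp only [hT, hTH, hK1, hK2]
  have hB : ∀ t ∈ E₀.powerset, T (insert e t) = TC t := by
    intro t ht
    have ht' := Finset.mem_powerset.mp ht
    have hK1 : K (insert e t) = {y | r y ∈ Kc t} := contract_e t
    have hK2 : K ((insert e' E) \ (insert e t)) = {y | r y ∈ Kc (E₀ \ t)} := by
      rw [compl_b t ht']; exact contract_e' (E₀ \ t)
    simp only [hT, hTC, hK1, hK2, hfr, hgr]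
    exact if_congr (and_congr (not_congr (hzr _)) (not_congr (hzr _))) rfl rfl
  have hC : ∀ t ∈ E₀.powerset, T (insert e' t) = TC t := by
    intro t ht
    have ht' := Finset.mem_powerset.mp ht
    have hK1 : K (insert e' t) = {y | r y ∈ Kc t} := contract_e' t
    have hK2 : K ((insert e' E) \ (insert e' t)) = {y | r y ∈ Kc (E₀ \ t)} := by
      rw [compl_c t ht']; exact contract_e (E₀ \ t)
    simp only [hT, hTC, hK1, hK2, hfr, hgr]
    exact if_congr (and_congr (not_congr (hzr _)) (not_congr (hzr _))) rfl rfl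
  rw [Finset.sum_congr rfl hA, Finset.sum_congr rfl hB, Finset.sum_congr rfl hC, Finset.sum_congr rfl hD]
  -- `T'(H)` as the sum over `E₀` of the two colours of `e`
  have hH : ∑ t ∈ E₀.powerset, TH t + ∑ t ∈ E₀.powerset, TH (insert e t) = ∑ s ∈ E.powerset, TH s := by
    rw [hE, Finset.sum_powerset_insert heE₀]
  have hH0 : 0 ≤ ∑ s ∈ E.powerset, TH s := by
    rw [← Finset.sum_filter]; exact h₁'
  have hC0 : 0 ≤ ∑ t ∈ E₀.powerset, TC t := by
    rw [← Finset.sum_filter]; exact h₂'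
  linarith

end Coefficientwise

end Summit.CriticalPhenomena.PercolationContinuityZ3.Theorems
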